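import Literature.AnabelianGeometry.EtaleTheta.BiKummerRoots
import Literature.AlgebraicGeometry.Frobenioids.ModelFrobenioidPreSteps

/-!
# [EtTh] Prop 4.3 (iii): the difference of the two sections of a bi-Kummer root is `μ_N`-valued

Mochizuki, *The étale theta function …*, Publ. RIMS **45** (2009), §4, Prop. 4.3 (iii), PDF p.91
[cite: MochizukiEtTh2009, Prop 4.3 p.91]: "the difference `s'_N{}^{gp} · (s''_N{}^{gp})⁻¹` determines a
twisted homomorphism `H_{B_N} → μ_N(B_N)` … which is equal to the Kummer class … `κ_{f|_{B_N}}`";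
printed proof: "follows immediately from the definitions".  abc-iut cell, layer L2, ROW `EtTh:Prop4.3`
(seat abc-iut-L6-t12); the statement is abc-iut-L2-t3's `BiKummerSetting.Prop43_iii` (`BiKummerRoots.lean`,
first clause: the values `s'(h) · s''(h)⁻¹` lie in `μ_N(B_N)`), over the data `BiKummerRoot`
(`s_N^triv`, `ident : H_{A_N} ≅ H_{B_N}`, `s'_N{}^{gp}`, `s''_N{}^{gp}`, the two commutation relations).

What is proved here, for the model Frobenioid `C = S.tf.category` ([FrdI] Thm. 5.2):
* unconditionally: `Base(s'^{gp}(h)) = Base(s''^{gp}(h))`, hence `s'^{gp}(h) · s''^{gp}(h)⁻¹ ∈ O^×(B_N)`;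
* the `N`-torsion: the rational function of the difference is the Kummer cocycle
  `(s^triv(h) · f_N) / f_N` of the `N`-th root `f_N = s'_N · (s''_N)⁻¹` (computed through the [FrdI]
  Thm. 5.2 (ii) dictionary `toB : O^×(A^birat) ↪ B(A_D)^×`, as in `Discharge/Sec4FractionPairs.lean`),
  whose `N`-th power is `(s^triv(h) · f|_{A_N}) / f|_{A_N} = 1` because `s^triv(h) ∈ H_{A_N}` (the section
  property `BiKummerRoot.autBase_striv` / `striv_mem` of the v2 statement file; in print `s_N^triv`
  "arises from a base-Frobenius pair of `A_N`") fixes `f|_{A_N}` (`(N, H_⊙, f|_{A_N})`-saturation).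
Hence `Prop43_iii` is DISCHARGED modulo: `Φ` divisorial, `B` group-like, and the dictionary (`toB`
computing fractions and compatible with the `Aut_C(A)`-action) — for abc-iut-L2-t9's `mkOfModel` the
dictionary is the identity (`Discharge/Sec4Model.lean`).  Also: the UNIQUENESS half of Prop. 4.3 (i)
(`sNum_sDen_unique`).  (v2 of this file: re-targeted to `BiKummerRoots.lean` v2 — the hypothesis
`hstriv` of v1 is now the theorem `BiKummerRoot.striv_mem`, and v1's degeneracy witness for the
un-repaired Prop. 4.3 (ii) is dropped, the statement having been repaired.)
-/

noncomputable section

namespace Literature.AnabelianGeometry.EtaleTheta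

open CategoryTheory Opposite Literature.AlgebraicGeometry.Frobenioids
open Literature.AlgebraicGeometry.Frobenioids.PreFrobenioid (pull_inv_pull_eq pull_pull_inv_eq
  pull_injective)

universe u₀ v₀ u v w

variable {K : Type u₀} [Field K]

namespace BiKummerSetting

variable {X : SemiGraphs.TemperedArithmeticGroup.{u₀} K} {D₀ : Type u₀} [Category.{v₀} D₀]
  {V : FrdIMonoidStub.{w}} {T : RealifiedDivisorMonoids (D₀ := D₀) V} {D : Type u} [Category.{v} D]
  {VD : FrdICatStub.{u, v, w} D} {S : BiKummerSetting X T D VD}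

namespace BiKummerRoot

variable {A B : S.C} {f : S.biratUnits A} {P : S.FractionPair f B} {N : ℕ+}
  {pullFrac : ∀ {A A' : S.C} (_ : A' ⟶ A), S.biratUnits A → S.biratUnits A'}
  {R : S.NthRoot f P N pullFrac} {hA : S.IsGalois R.AN} {hB : S.IsGalois R.BN}
  (K : S.BiKummerRoot R hA hB)

/-- The commutation relation for `s'_N{}^{gp}`, indexed by `h ∈ H_{B_N}`:
`s'^{gp}(h) ∘ s'_N = s'_N ∘ s^triv(ident⁻¹ h)`. [cite: MochizukiEtTh2009, Prop 4.3(i) p.90] -/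
theorem comm_num' (h : S.HA R.BN hB) :
    R.pair.num ≫ (K.sNum h).hom = (K.striv (K.ident.symm h)).hom ≫ R.pair.num := by
  have e := K.comm_num (K.ident.symm h)
  rwa [MulEquiv.apply_symm_apply] at e

/-- The commutation relation for `s''_N{}^{gp}`, indexed by `h ∈ H_{B_N}`.
[cite: MochizukiEtTh2009, Prop 4.3(i) p.90] -/
theorem comm_den' (h : S.HA R.BN hB) :
    R.pair.den ≫ (K.sDen h).hom = (K.striv (K.ident.symm h)).hom ≫ R.pair.den := by
  have e := K.comm_den (K.ident.symm h)
  rwa [MulEquiv.apply_symm_apply] at e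

/-- `Base(s'^{gp}(h)) = Base(s''^{gp}(h))`: both equal the transport of `Base(s^triv(h))` along the
base-isomorphism `Base(s'_N) = Base(s''_N)` (the "[base-equivalent!]" of p.90).
[cite: MochizukiEtTh2009, Prop 4.3(i) p.90] -/
theorem baseMap_sNum_eq_baseMap_sDen (h : S.HA R.BN hB) :
    ModelFrobenioid.baseMap (K.sNum h).hom = ModelFrobenioid.baseMap (K.sDen h).hom := by
  haveI : IsIso (ModelFrobenioid.baseMap R.pair.num) := R.pair.isPreStep_num.2
  have hb : ModelFrobenioid.baseMap R.pair.num = ModelFrobenioid.baseMap R.pair.den := R.pair.base_eq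
  have e1 := congrArg ModelFrobenioid.baseMap (K.comm_num' h)
  have e2 := congrArg ModelFrobenioid.baseMap (K.comm_den' h)
  rw [ModelFrobenioid.baseMap_comp, ModelFrobenioid.baseMap_comp] at e1 e2
  rw [← hb] at e2
  exact (cancel_epi (ModelFrobenioid.baseMap R.pair.num)).mp (e1.trans e2.symm)

/-- **Prop. 4.3 (iii), unit-valuedness**: `s'^{gp}(h) · s''^{gp}(h)⁻¹ ∈ O^×(B_N)` (a base-identity linear
automorphism) for every `h ∈ H_{B_N}` — unconditional over the model Frobenioid.
[cite: MochizukiEtTh2009, Prop 4.3(iii) p.91] -/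
theorem sNum_mul_sDen_inv_mem_units (h : S.HA R.BN hB) : K.sNum h * (K.sDen h)⁻¹ ∈ S.units R.BN := by
  refine ⟨?_, ?_⟩
  · change ModelFrobenioid.baseMap ((K.sDen h).inv ≫ (K.sNum h).hom) = 𝟙 _
    rw [ModelFrobenioid.baseMap_comp, K.baseMap_sNum_eq_baseMap_sDen h, ← ModelFrobenioid.baseMap_comp,
      Iso.inv_hom_id, ModelFrobenioid.baseMap_id]
  · change ModelFrobenioid.degFr ((K.sDen h).inv ≫ (K.sNum h).hom) = 1
    rw [ModelFrobenioid.degFr_comp, ModelFrobenioid.degFr_eq_one_of_isIso (K.sNum h).hom,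
      ModelFrobenioid.degFr_eq_one_of_isIso (K.sDen h).inv, mul_one]

/-- **Prop. 4.3 (iii), the Kummer-cocycle identity**: writing `x = toB(f_N)` for the `N`-th root
(`f_N = s'_N · (s''_N)⁻¹`, via the dictionary) and `τ = s^triv(ident⁻¹ h)`,
`Base(s'_N)^* u_{s'^{gp}(h)} · x = Base(τ)^* x · Base(s'_N)^* u_{s''^{gp}(h)}` in `B(Base A_N)` — i.e. the
difference of the two sections is the Kummer cocycle `(τ · f_N)/f_N` ("follows immediately from the
definitions", p.91). [cite: MochizukiEtTh2009, Prop 4.3(iii) p.91] -/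
theorem pull_unit_sNum_mul_root
    (hBg : Objectwise (fun M _ => IsGroupLike M) S.tf.ratFnFunctor)
    (toB : ∀ A : S.C, S.biratUnits A →* (S.tf.ratFnFunctor.obj (op A.base))ˣ)
    (hfrac : ∀ {A B : S.C} (s' s'' : A ⟶ B) (h' : S.IsPreStep s') (h'' : S.IsPreStep s'')
      (hb : PreFrobenioid.BaseEquivalent S.F s' s''),
      (toB A (S.fracOf s' s'' h' h'' hb) : S.tf.ratFnFunctor.obj (op A.base)) *
        ModelFrobenioid.unit s'' = ModelFrobenioid.unit s')
    (h : S.HA R.BN hB) :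
    pull S.tf.ratFnFunctor (ModelFrobenioid.baseMap R.pair.num) (ModelFrobenioid.unit (K.sNum h).hom) *
        (toB R.AN R.root : S.tf.ratFnFunctor.obj (op R.AN.base)) =
      pull S.tf.ratFnFunctor (ModelFrobenioid.baseMap (K.striv (K.ident.symm h)).hom)
          (toB R.AN R.root : S.tf.ratFnFunctor.obj (op R.AN.base)) *
        pull S.tf.ratFnFunctor (ModelFrobenioid.baseMap R.pair.num)
          (ModelFrobenioid.unit (K.sDen h).hom) := by
  haveI : IsCancelMul (S.tf.ratFnFunctor.obj (op R.AN.base)) :=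
    isIntegral_iff_isCancelMul.mp (hBg R.AN.base).isPreDivisorial.isIntegral
  have hb : ModelFrobenioid.baseMap R.pair.num = ModelFrobenioid.baseMap R.pair.den := R.pair.base_eq
  have hn1 : ModelFrobenioid.degFr R.pair.num = 1 := R.pair.isPreStep_num.1
  have hd1 : ModelFrobenioid.degFr R.pair.den = 1 := R.pair.isPreStep_den.1
  have hx := hfrac R.pair.num R.pair.den R.pair.isPreStep_num R.pair.isPreStep_den R.pair.base_eq
  rw [R.pair.frac_eq] at hx
  -- units of the two commutation relations
  have e1 := congrArg ModelFrobenioid.unit (K.comm_num' h)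
  have e2 := congrArg ModelFrobenioid.unit (K.comm_den' h)
  rw [ModelFrobenioid.unit_comp_of_degFr_eq_one _ (ModelFrobenioid.degFr_eq_one_of_isIso _),
    ModelFrobenioid.unit_comp_pull, hn1, PNat.one_coe, pow_one] at e1
  rw [ModelFrobenioid.unit_comp_of_degFr_eq_one _ (ModelFrobenioid.degFr_eq_one_of_isIso _),
    ModelFrobenioid.unit_comp_pull, hd1, PNat.one_coe, pow_one, ← hb] at e2
  -- e1 : bn^* u₁ * u_n = τ^* u_n * u_τ ;  e2 : bn^* u₂ * u_d = τ^* u_d * u_τ ;  hx : x * u_d = u_n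
  apply mul_right_cancel (b := ModelFrobenioid.unit R.pair.den)
  calc pull S.tf.ratFnFunctor (ModelFrobenioid.baseMap R.pair.num) (ModelFrobenioid.unit (K.sNum h).hom) *
          (toB R.AN R.root : S.tf.ratFnFunctor.obj (op R.AN.base)) * ModelFrobenioid.unit R.pair.den
        = pull S.tf.ratFnFunctor (ModelFrobenioid.baseMap R.pair.num) (ModelFrobenioid.unit (K.sNum h).hom) *
          ModelFrobenioid.unit R.pair.num := by rw [mul_assoc, hx]
    _ = pull S.tf.ratFnFunctor (ModelFrobenioid.baseMap (K.striv (K.ident.symm h)).hom)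
          (ModelFrobenioid.unit R.pair.num) * ModelFrobenioid.unit (K.striv (K.ident.symm h)).hom := e1
    _ = pull S.tf.ratFnFunctor (ModelFrobenioid.baseMap (K.striv (K.ident.symm h)).hom)
          (toB R.AN R.root : S.tf.ratFnFunctor.obj (op R.AN.base)) *
          (pull S.tf.ratFnFunctor (ModelFrobenioid.baseMap (K.striv (K.ident.symm h)).hom)
            (ModelFrobenioid.unit R.pair.den) * ModelFrobenioid.unit (K.striv (K.ident.symm h)).hom) := by
          rw [← hx, map_mul, mul_assoc]
    _ = pull S.tf.ratFnFunctor (ModelFrobenioid.baseMap (K.striv (K.ident.symm h)).hom)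
          (toB R.AN R.root : S.tf.ratFnFunctor.obj (op R.AN.base)) *
          (pull S.tf.ratFnFunctor (ModelFrobenioid.baseMap R.pair.num) (ModelFrobenioid.unit (K.sDen h).hom) *
            ModelFrobenioid.unit R.pair.den) := by rw [← e2]
    _ = _ := by rw [mul_assoc]

/-- **Prop. 4.3 (iii), `N`-torsion**: `(s'^{gp}(h) · s''^{gp}(h)⁻¹)^N = 1`: `s^triv(ident⁻¹ h)` lies in
`H_{A_N}` (`BiKummerRoot.striv_mem`: in print `s_N^triv` arises from a base-Frobenius pair, hence is a
section over `H_{A_N}`), so it fixes `f|_{A_N} = f_N^N` (`(N, H_⊙, f|_{A_N})`-saturation of `A_N`) and the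
Kummer cocycle of `f_N` is `N`-torsion; `Φ` divisorial, `B` group-like, and the dictionary with its
compatibility `haut` with the `Aut_C(A)`-action ([FrdI] Thm. 5.2 (ii)).
[cite: MochizukiEtTh2009, Prop 4.3(iii) p.91] -/
theorem sNum_mul_sDen_inv_pow_eq_one
    (hΦd : Objectwise (fun M _ => IsDivisorial M) S.tf.divisorMonoid)
    (hBg : Objectwise (fun M _ => IsGroupLike M) S.tf.ratFnFunctor)
    (toB : ∀ A : S.C, S.biratUnits A →* (S.tf.ratFnFunctor.obj (op A.base))ˣ)
    (hfrac : ∀ {A B : S.C} (s' s'' : A ⟶ B) (h' : S.IsPreStep s') (h'' : S.IsPreStep s'')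
      (hb : PreFrobenioid.BaseEquivalent S.F s' s''),
      (toB A (S.fracOf s' s'' h' h'' hb) : S.tf.ratFnFunctor.obj (op A.base)) *
        ModelFrobenioid.unit s'' = ModelFrobenioid.unit s')
    (haut : ∀ {A : S.C} (σ : Aut A) (x : S.biratUnits A),
      (toB A (S.biratAut A σ x) : S.tf.ratFnFunctor.obj (op A.base)) =
        pull S.tf.ratFnFunctor (ModelFrobenioid.baseMap σ.inv) (toB A x : S.tf.ratFnFunctor.obj (op A.base)))
    (h : S.HA R.BN hB) : (K.sNum h * (K.sDen h)⁻¹) ^ (N : ℕ) = 1 := by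
  have hstriv : K.striv (K.ident.symm h) ∈ S.HA R.AN hA := striv_mem S K (K.ident.symm h)
  haveI : IsCancelMul (S.tf.ratFnFunctor.obj (op R.AN.base)) :=
    isIntegral_iff_isCancelMul.mp (hBg R.AN.base).isPreDivisorial.isIntegral
  haveI : IsCancelMul (S.tf.ratFnFunctor.obj (op R.BN.base)) :=
    isIntegral_iff_isCancelMul.mp (hBg R.BN.base).isPreDivisorial.isIntegral
  haveI : IsIso (ModelFrobenioid.baseMap R.pair.num) := R.pair.isPreStep_num.2
  set τ := K.striv (K.ident.symm h) with hτ
  -- the Kummer-cocycle identity and its `N`-th power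
  have E := K.pull_unit_sNum_mul_root hBg toB hfrac h
  -- `x^N = toB (f|_{A_N})` is fixed by `τ ∈ H_{A_N}`
  have hxN : (toB R.AN R.root : S.tf.ratFnFunctor.obj (op R.AN.base)) ^ (N : ℕ) =
      (toB R.AN (pullFrac R.αData.α₁ f) : S.tf.ratFnFunctor.obj (op R.AN.base)) := by
    rw [← Units.val_pow_eq_pow_val, ← map_pow, R.pow_root]
  have hfix : pull S.tf.ratFnFunctor (ModelFrobenioid.baseMap τ.hom)
      (toB R.AN (pullFrac R.αData.α₁ f) : S.tf.ratFnFunctor.obj (op R.AN.base)) =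
      (toB R.AN (pullFrac R.αData.α₁ f) : S.tf.ratFnFunctor.obj (op R.AN.base)) := by
    have hmem : τ⁻¹ ∈ S.HA R.AN hA := Subgroup.inv_mem _ hstriv
    have e : (toB R.AN (S.biratAut R.AN τ⁻¹ (pullFrac R.αData.α₁ f)) : S.tf.ratFnFunctor.obj (op R.AN.base)) =
        (toB R.AN (pullFrac R.αData.α₁ f) : S.tf.ratFnFunctor.obj (op R.AN.base)) :=
      congrArg (fun y : S.biratUnits R.AN => (toB R.AN y : S.tf.ratFnFunctor.obj (op R.AN.base)))
        (R.isSaturated.fixed τ⁻¹ hmem)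
    rwa [haut] at e
  have EN := congrArg (fun y => y ^ (N : ℕ)) E
  simp only [mul_pow] at EN
  rw [← map_pow, ← map_pow, ← map_pow, hxN, hfix, mul_comm _ (toB R.AN (pullFrac R.αData.α₁ f) :
    S.tf.ratFnFunctor.obj (op R.AN.base))] at EN
  -- EN : bn^* (u₁^N) * X = X * bn^* (u₂^N), with X = toB (f|_{A_N})
  have hpow : ModelFrobenioid.unit (K.sNum h).hom ^ (N : ℕ) = ModelFrobenioid.unit (K.sDen h).hom ^ (N : ℕ) := by
    apply pull_injective (ModelFrobenioid.baseMap R.pair.num)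
    exact mul_left_cancel EN
  -- the rational function of `w = s'(h) · s''(h)⁻¹` and of `w^N`
  have hw : K.sNum h * (K.sDen h)⁻¹ ∈ S.units R.BN := K.sNum_mul_sDen_inv_mem_units h
  let w' : ModelFrobenioid.units R.BN := ⟨K.sNum h * (K.sDen h)⁻¹, hw⟩
  have hu : ModelFrobenioid.unit (K.sNum h * (K.sDen h)⁻¹).hom *
      pull S.tf.ratFnFunctor (ModelFrobenioid.baseMap (K.sDen h).inv) (ModelFrobenioid.unit (K.sDen h).hom) =
      pull S.tf.ratFnFunctor (ModelFrobenioid.baseMap (K.sDen h).inv) (ModelFrobenioid.unit (K.sNum h).hom) := by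
    have e0 := congrArg ModelFrobenioid.unit (K.sDen h).inv_hom_id
    rw [ModelFrobenioid.unit_comp_of_degFr_eq_one _ (ModelFrobenioid.degFr_eq_one_of_isIso _),
      ModelFrobenioid.unit_id] at e0
    change ModelFrobenioid.unit ((K.sDen h).inv ≫ (K.sNum h).hom) * _ = _
    rw [ModelFrobenioid.unit_comp_of_degFr_eq_one _ (ModelFrobenioid.degFr_eq_one_of_isIso _), mul_assoc,
      mul_comm (ModelFrobenioid.unit (K.sDen h).inv), e0, mul_one]
  have huN : ModelFrobenioid.unit (K.sNum h * (K.sDen h)⁻¹).hom ^ (N : ℕ) = 1 := by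
    have e := congrArg (fun y => y ^ (N : ℕ)) hu
    simp only [mul_pow] at e
    rw [← map_pow, ← map_pow, hpow] at e
    exact mul_right_cancel (e.trans (one_mul _).symm)
  -- `O^×(B_N) ↪ B(Base B_N)^×` is injective (`Φ` integral): `w^N = 1`
  have key : ModelFrobenioid.unitsToRatFn R.BN (w' ^ (N : ℕ)) = ModelFrobenioid.unitsToRatFn R.BN 1 := by
    rw [map_pow, map_one]
    apply Units.ext
    rw [Units.val_pow_eq_pow_val, ModelFrobenioid.coe_unitsToRatFn, Units.val_one]
    exact huN
  have hwN := ModelFrobenioid.unitsToRatFn_injective (hΦd R.BN.base).isPreDivisorial.isIntegral key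
  simpa [w'] using congrArg Subtype.val hwN

/-- **[EtTh] Prop. 4.3 (iii), first clause** for ONE bi-Kummer root datum: `s'^{gp}(h) · s''^{gp}(h)⁻¹ ∈
μ_N(B_N)`, under the hypotheses of `sNum_mul_sDen_inv_pow_eq_one`. [cite: MochizukiEtTh2009, Prop 4.3(iii) p.91] -/
theorem sNum_mul_sDen_inv_mem_mu
    (hΦd : Objectwise (fun M _ => IsDivisorial M) S.tf.divisorMonoid)
    (hBg : Objectwise (fun M _ => IsGroupLike M) S.tf.ratFnFunctor)
    (toB : ∀ A : S.C, S.biratUnits A →* (S.tf.ratFnFunctor.obj (op A.base))ˣ)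
    (hfrac : ∀ {A B : S.C} (s' s'' : A ⟶ B) (h' : S.IsPreStep s') (h'' : S.IsPreStep s'')
      (hb : PreFrobenioid.BaseEquivalent S.F s' s''),
      (toB A (S.fracOf s' s'' h' h'' hb) : S.tf.ratFnFunctor.obj (op A.base)) *
        ModelFrobenioid.unit s'' = ModelFrobenioid.unit s')
    (haut : ∀ {A : S.C} (σ : Aut A) (x : S.biratUnits A),
      (toB A (S.biratAut A σ x) : S.tf.ratFnFunctor.obj (op A.base)) =
        pull S.tf.ratFnFunctor (ModelFrobenioid.baseMap σ.inv) (toB A x : S.tf.ratFnFunctor.obj (op A.base)))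
    (h : S.HA R.BN hB) : K.sNum h * (K.sDen h)⁻¹ ∈ S.mu R.BN N :=
  ⟨K.sNum_mul_sDen_inv_mem_units h, K.sNum_mul_sDen_inv_pow_eq_one hΦd hBg toB hfrac haut h⟩

/-! ### Proposition 4.3 (i): uniqueness of the bi-Kummer root for given `s_N^triv`, `ident` -/

/-- **Prop. 4.3 (i), uniqueness half** (p.90: "there exist unique group homomorphisms `s'_N{}^{gp},
s''_N{}^{gp}` …"): two bi-Kummer root data on the same `N`-th root with the same `s_N^triv` and the same
identification `H_{A_N} ≅ H_{B_N}` have the same sections — because the pre-steps `s'_N`, `s''_N` are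
epimorphisms of `C` (the model Frobenioid is totally epimorphic on base-isomorphisms; `Φ` divisorial,
`B` group-like). The EXISTENCE half uses the `H_⊙`-invariance of `Div(s'_N)`, which needs the Galois-
equivariance of `Base(α)` not carried by the typed setting (merge-gated). [cite: MochizukiEtTh2009, Prop 4.3(i) p.90] -/
theorem sNum_sDen_unique
    (hΦd : Objectwise (fun M _ => IsDivisorial M) S.tf.divisorMonoid)
    (hBg : Objectwise (fun M _ => IsGroupLike M) S.tf.ratFnFunctor)
    (K' : S.BiKummerRoot R hA hB) (hs : K'.striv = K.striv) (hi : K'.ident = K.ident) :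
    K'.sNum = K.sNum ∧ K'.sDen = K.sDen := by
  haveI : IsIso (ModelFrobenioid.baseMap R.pair.num) := R.pair.isPreStep_num.2
  haveI : IsIso (ModelFrobenioid.baseMap R.pair.den) := R.pair.isPreStep_den.2
  refine ⟨MonoidHom.ext fun h => ?_, MonoidHom.ext fun h => ?_⟩
  · apply Iso.ext
    apply ModelFrobenioid.cancel_left_of_isIso_baseMap hΦd hBg R.pair.num
    rw [K'.comm_num' h, K.comm_num' h, hs, hi]
  · apply Iso.ext
    apply ModelFrobenioid.cancel_left_of_isIso_baseMap hΦd hBg R.pair.den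
    rw [K'.comm_den' h, K.comm_den' h, hs, hi]

end BiKummerRoot

/-- **[EtTh] Proposition 4.3 (iii) — the named fact `Prop43_iii` DISCHARGED modulo [FrdI] facts**: for
`Φ` divisorial, `B` group-like and the [FrdI] Thm. 5.2 (ii) dictionary `toB` (computing fractions,
compatible with the `Aut_C(A)`-action), the difference `s'^{gp}(h) · s''^{gp}(h)⁻¹` of the two sections of
any bi-Kummer root lies in `μ_N(B_N)` for all `h ∈ H_{B_N}`. [cite: MochizukiEtTh2009, Prop 4.3(iii) p.91] -/
theorem prop43_iii_of (pullFrac : ∀ {A A' : S.C} (_ : A' ⟶ A), S.biratUnits A → S.biratUnits A')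
    (hΦd : Objectwise (fun M _ => IsDivisorial M) S.tf.divisorMonoid)
    (hBg : Objectwise (fun M _ => IsGroupLike M) S.tf.ratFnFunctor)
    (toB : ∀ A : S.C, S.biratUnits A →* (S.tf.ratFnFunctor.obj (op A.base))ˣ)
    (hfrac : ∀ {A B : S.C} (s' s'' : A ⟶ B) (h' : S.IsPreStep s') (h'' : S.IsPreStep s'')
      (hb : PreFrobenioid.BaseEquivalent S.F s' s''),
      (toB A (S.fracOf s' s'' h' h'' hb) : S.tf.ratFnFunctor.obj (op A.base)) *
        ModelFrobenioid.unit s'' = ModelFrobenioid.unit s')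
    (haut : ∀ {A : S.C} (σ : Aut A) (x : S.biratUnits A),
      (toB A (S.biratAut A σ x) : S.tf.ratFnFunctor.obj (op A.base)) =
        pull S.tf.ratFnFunctor (ModelFrobenioid.baseMap σ.inv) (toB A x : S.tf.ratFnFunctor.obj (op A.base))) :
    S.Prop43_iii pullFrac :=
  fun _ _ _ K h => K.sNum_mul_sDen_inv_mem_mu hΦd hBg toB hfrac haut h


end BiKummerSetting

end Literature.AnabelianGeometry.EtaleTheta

end
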